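import Literature.LinearAlgebra.RootSystem.AffineWeylGroupFundamentalDomain
import Literature.LinearAlgebra.RootSystem.AffineWeylGroupParabolicFinite
import HarnessLib

/-!
# The lattice point of a cell: `Ā∘ ∩ Q = {0}`, `wĀ∘ ∩ Q = {w(0)}`, same point iff same coset `wW`; `Ā∘ ∩ P(Φ) = Ω·0`
# (Iwahori–Matsumoto 1965 Proposition 1.17, Corollary 1.20 and the remark following it)

N. Iwahori, H. Matsumoto, *On some Bruhat decomposition and the structure of the Hecke rings of p-adic Chevalley groups*, Publ. Math. IHÉS 25 (1965)
[IwahoriMatsumoto1965] (held `paper:doi-10-1007-bf02684396`, p0013–p0014 = pp. 248–249), §1.7: «**Proposition 1.17.** The intersection of `P^⊥` with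
the closure `𝔇̄∘` of `𝔇∘` consists of `0` and the `ε_i` with `(α₀, ε_i) = 1`. … **Proposition 1.18.** The mapping from the set `{0} ∪ {ε_i; (α₀, ε_i) = 1}`
onto `Ω` defined by `0 → 1`, `ε_i → T(ε_i) w_{Π(i)} w_Π` is bijective. … **Corollary 1.20** (cf. [5]). For any cell `𝔇`, the intersection `𝔇̄ ∩ P_r^⊥`
consists of a single element. In particular `𝔇̄∘ ∩ P_r^⊥ = {0}`. *Proof.* Since `P_r^⊥` is stable under `D'W` and `D'W` is transitive on `𝔉`, it is
enough to show that `𝔇̄∘ ∩ P_r^⊥ = {0}`. Let `x ≠ 0` be in `𝔇̄∘ ∩ P_r^⊥`. Then … there is some `i` with `x = ε_i`, `(α₀, ε_i) = 1`. Now since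
`x ∈ P_r^⊥`, we have `T(x) = T(ε_i) ∈ D'`. Hence `T(ε_i) w_{Π_i} w_Π ∈ D'W ∩ Ω = {1}` which is a contradiction, Q.E.D. The unique intersection point
`𝔇̄ ∩ P_r^⊥` is called the lattice point associated with the cell `𝔇`. Note that for `σ, τ ∈ D'W`, `σ𝔇∘` and `τ𝔇∘` have the same associated lattice
point if and only if `σW = τW`. In fact, the lattice point associated with `σ𝔇∘` is clearly `σ(0)`, hence it is enough to show that
`σ(0) = τ(0) ⟺ σW = τW`. But this is obvious since `σ(0) = τ(0) ⟺ σ⁻¹τ(0) = 0 ⟺ σ⁻¹τ ∈ W`.»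

THIS FILE (lane `lit-hodgefound`, prover seat p40, generation 47, row g47-#4; THEOREMS ONLY — no definition, instance, notation or named fact; net
debt 0), conventions of the `AffineWeylGroup*` files: weight space `M` with the levels `⟨x, α^∨⟩` of the coroots; `W_a` translates by the ROOT
lattice `Q = P.rootSpan ℤ` (IM's `P_r^⊥`, `D'`), `Ŵ_a` by the weight lattice `P(Φ) = weightLattice P` (IM's `P^⊥`, `D`) — the printed `W_a(Φ)`
is this construction for `P.flip`; the closed fundamental cell is `Ā∘ = {x | 0 ≤ ⟨x, α^∨⟩ ≤ 1 for all α ≻ 0}` (row g44-#9, Humphreys §4.8), a cell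
`σ𝔇̄∘` is the image `σ '' Ā∘`, and `Ω = {o ∈ Ŵ_a | oA∘ = A∘}` in element language (rows g44-#8 ∕ #11). IM's `ε_i` with `(α₀, ε_i) = 1` are the
minuscule fundamental weights (row g45-#7); «`0` or minuscule» is the tree's predicate `(∀ j ∈ Δ, ⟨x, α_j^∨⟩ ∈ ℕ) ∧ ∀ α, ⟨x, α^∨⟩ ∈ {0, 1, -1}`
(`FundamentalGroupOrder`, Bourbaki VIII §7 no. 3).

* §1 ★★★ **`eq_zero_of_mem_closedFundamentalAlcove_of_mem_rootSpan`** ∕ **`closedFundamentalAlcove_inter_rootSpan`** (COROLLARY 1.20, «in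
  particular»: `Ā∘ ∩ Q = {0}` — here from the fundamental-domain theorem of row g44-#9: `Q = W_a·0` and an orbit meets `Ā∘` once).
* §2 ★★★ **`eq_apply_zero_of_mem_image_closedFundamentalAlcove`** ∕ **`image_closedFundamentalAlcove_inter_rootSpan`** (COROLLARY 1.20: `wĀ∘ ∩ Q =
  {w(0)}` for `w ∈ W_a` — «the lattice point associated with `σ𝔇∘` is clearly `σ(0)`»).
* §3 ★★ **`apply_zero_eq_apply_zero_iff_exists_weylGroup`** («`σ(0) = τ(0) ⟺ σW = τW`»: iff `τ = σ·g` for some `g ∈ W`), ★★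
  **`apply_zero_eq_apply_zero_iff_quotient_eq`** (the same with Mathlib's left cosets `W_a ⧸ W`).
* §4 ★★ **`closedFundamentalAlcove_inter_weightLattice`** (PROPOSITION 1.17: `Ā∘ ∩ P(Φ)` = «`0` and the minuscule weights»), ★★★
  **`bijOn_apply_zero_stabilizer`** (PROPOSITION 1.18 ON POINTS: `o ↦ o(0)` is a bijection from `Ω` onto `Ā∘ ∩ P(Φ)` — every weight of the closed
  cell is the `Ω`-translate of the origin, rows g44-#8 `Ŵ_a = W_a·Ω` and g44-#9), ★ **`closedFundamentalAlcove_inter_weightLattice_eq_image`**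
  (`Ā∘ ∩ P(Φ) = Ω·0`).

BY NAME, nothing restated: rows g44-#1 (`affineWeylGroup`, `affineHom`, `weightLattice`, `extendedAffineWeylGroup`, `constVAdd_mem_affineWeylGroup_of_mem_rootSpan`,
`constVAdd_mem_extendedAffineWeylGroup`), g44-#4 (`mem_affineWeylGroup_iff_apply_zero_mem_rootSpan`, `apply_zero_mem_weightLattice`), g44-#8
(`exists_mem_affineWeylGroup_mul_of_mem_extendedAffineWeylGroup`, `forall_coroot'_apply_zero_mem_of_image_eq`, `eq_of_apply_zero_sub_apply_zero_mem_rootSpan`),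
g44-#9 (`eq_of_apply_eq_of_mem_closedFundamentalAlcove`), g44-#13 (`eq_affineHom_of_apply_zero`), g32 `coroot'_nonneg_of_isPos_of_forall_mem_support`,
g36 `coroot'_indexNeg`; Mathlib `QuotientGroup.eq`, `Subgroup.mem_subgroupOf`.

## Scope caveats

Cells are the images `σ '' Ā∘` of the closed fundamental cell under `σ ∈ W_a` (no topology is used); IM's description of the `W`-part `w_{Π(i)} w_Π` of
the elements of `Ω` (Prop. 1.18) is not repeated here (row g45-#7 treats `Ω` and the special nodes). Finite reduced crystallographic root systems over
an ordered field of characteristic zero, `η` with `hη` (highest coroot).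

## References

* [IwahoriMatsumoto1965] N. Iwahori, H. Matsumoto, Publ. Math. IHÉS 25 (1965) 5–48, §1.7 Proposition 1.17, Proposition 1.18, Corollary 1.20 and Remark
  (pp. 248–249).
* [Humphreys1990] J. E. Humphreys, *Reflection Groups and Coxeter Groups*, CUP (1990), §4.8 Theorem (fundamental domain), §4.9 («special points»; cite-only).
* [Bourbaki2002LieGroups46] N. Bourbaki, *Lie Groups and Lie Algebras, Chapters 4–6*, Ch. VI §2 no. 2 Cor. of Prop. 5, no. 3 («special points»; cite-only).
-/

noncomputable section

open Module Set Function

namespace Literature.LinearAlgebra.RootSystem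

namespace Base

variable {ι K M N : Type*} [Field K] [LinearOrder K] [IsStrictOrderedRing K] [AddCommGroup M] [Module K M]
  [AddCommGroup N] [Module K N] [Fintype ι] [DecidableEq ι]
  {P : RootPairing ι K M N} [CharZero K] [P.IsCrystallographic] [P.IsReduced] (b : P.Base)
  [Nonempty ι] {η : ι} (hη : ∀ k, P.coroot η - P.coroot k ∈ AddSubmonoid.closure (P.coroot '' (b.support : Set ι)))

/-! ## §1 Corollary 1.20 for the fundamental cell: `Ā∘ ∩ Q = {0}` -/

section Fundamental

include hη

/-- ★★★ **«IN PARTICULAR `𝔇̄∘ ∩ P_r^⊥ = {0}`»: THE ONLY POINT OF THE ROOT LATTICE IN THE CLOSED FUNDAMENTAL CELL IS THE ORIGIN** — a point `d ∈ Q`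
of `Ā∘ = {0 ≤ ⟨x, α^∨⟩ ≤ 1 ∀ α ≻ 0}` is `t(d)·0` with `t(d) ∈ W_a`, and a `W_a`-orbit meets `Ā∘` only once (row g44-#9). [cite: IwahoriMatsumoto1965, §1.7 Corollary 1.20 ("In particular 𝔇̄∘ ∩ P_r^⊥ = {0}")] [cite: Humphreys1990, §4.8 Theorem] -/
theorem eq_zero_of_mem_closedFundamentalAlcove_of_mem_rootSpan {d : M}
    (hd : d ∈ {x : M | ∀ i, b.IsPos i → 0 ≤ P.coroot' i x ∧ P.coroot' i x ≤ 1}) (hdQ : d ∈ P.rootSpan ℤ) : d = 0 := by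
  have h0 : (0 : M) ∈ {x : M | ∀ i, b.IsPos i → 0 ≤ P.coroot' i x ∧ P.coroot' i x ≤ 1} := fun i _ ↦ by
    rw [map_zero]; exact ⟨le_rfl, zero_le_one⟩
  symm
  refine eq_of_apply_eq_of_mem_closedFundamentalAlcove b hη (constVAdd_mem_affineWeylGroup_of_mem_rootSpan P hdQ) h0 hd ?_
  rw [AffineEquiv.constVAdd_apply, vadd_eq_add, add_zero]

/-- ★★★ **COROLLARY 1.20 FOR `𝔇∘`: `Ā∘ ∩ Q = {0}`.** [cite: IwahoriMatsumoto1965, §1.7 Corollary 1.20 ("In particular 𝔇̄∘ ∩ P_r^⊥ = {0}")] -/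
theorem closedFundamentalAlcove_inter_rootSpan :
    {x : M | ∀ i, b.IsPos i → 0 ≤ P.coroot' i x ∧ P.coroot' i x ≤ 1} ∩ (P.rootSpan ℤ : Set M) = {0} := by
  ext d
  simp only [mem_inter_iff, SetLike.mem_coe, mem_singleton_iff]
  refine ⟨fun h ↦ eq_zero_of_mem_closedFundamentalAlcove_of_mem_rootSpan b hη h.1 h.2, ?_⟩
  rintro rfl
  exact ⟨fun i _ ↦ by rw [map_zero]; exact ⟨le_rfl, zero_le_one⟩, Submodule.zero_mem _⟩

end Fundamental

/-! ## §2 Corollary 1.20: the lattice point `w(0)` of the cell `wĀ∘` -/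

section Cell

include hη

/-- ★★★ **COROLLARY 1.20: A POINT OF `Q` IN THE CELL `wĀ∘` (`w ∈ W_a`) IS `w(0)`** («since `P_r^⊥` is stable under `D'W` and `D'W` is transitive on `𝔉`,
it is enough to show that `𝔇̄∘ ∩ P_r^⊥ = {0}`»: pull back by `w⁻¹`, which preserves `Q`, row g44-#4). [cite: IwahoriMatsumoto1965, §1.7 Corollary 1.20 ("For any cell 𝔇, the intersection 𝔇̄ ∩ P_r^⊥ consists of a single element")] -/
theorem eq_apply_zero_of_mem_image_closedFundamentalAlcove {w : M ≃ᵃ[K] M} (hw : w ∈ affineWeylGroup P) {d : M}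
    (hd : d ∈ w '' {x : M | ∀ i, b.IsPos i → 0 ≤ P.coroot' i x ∧ P.coroot' i x ≤ 1}) (hdQ : d ∈ P.rootSpan ℤ) : d = w 0 := by
  obtain ⟨y, hy, rfl⟩ := hd
  -- `y = w⁻¹ d = (w⁻¹ t(d))(0) ∈ Q`
  have hyQ : y ∈ P.rootSpan ℤ := by
    have h1 : (w⁻¹ * AffineEquiv.constVAdd K M (w y)) 0 = y := by
      rw [AffineEquiv.coe_mul, comp_apply, AffineEquiv.constVAdd_apply, vadd_eq_add, add_zero, AffineEquiv.inv_def,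
        AffineEquiv.symm_apply_apply]
    rw [← h1]
    have hmem : w⁻¹ * AffineEquiv.constVAdd K M (w y) ∈ affineWeylGroup P :=
      mul_mem (inv_mem hw) (constVAdd_mem_affineWeylGroup_of_mem_rootSpan P hdQ)
    exact (mem_affineWeylGroup_iff_apply_zero_mem_rootSpan P (affineWeylGroup_le_extendedAffineWeylGroup P hmem)).mp hmem
  rw [eq_zero_of_mem_closedFundamentalAlcove_of_mem_rootSpan b hη hy hyQ]

/-- ★★★ **COROLLARY 1.20: `wĀ∘ ∩ Q = {w(0)}` — «the unique intersection point `𝔇̄ ∩ P_r^⊥` is called the lattice point associated with the cell `𝔇` …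
the lattice point associated with `σ𝔇∘` is clearly `σ(0)`».** [cite: IwahoriMatsumoto1965, §1.7 Corollary 1.20 and Remark] -/
theorem image_closedFundamentalAlcove_inter_rootSpan {w : M ≃ᵃ[K] M} (hw : w ∈ affineWeylGroup P) :
    w '' {x : M | ∀ i, b.IsPos i → 0 ≤ P.coroot' i x ∧ P.coroot' i x ≤ 1} ∩ (P.rootSpan ℤ : Set M) = {w 0} := by
  ext d
  simp only [mem_inter_iff, SetLike.mem_coe, mem_singleton_iff]
  refine ⟨fun h ↦ eq_apply_zero_of_mem_image_closedFundamentalAlcove b hη hw h.1 h.2, ?_⟩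
  rintro rfl
  refine ⟨⟨0, fun i _ ↦ by rw [map_zero]; exact ⟨le_rfl, zero_le_one⟩, rfl⟩, ?_⟩
  exact (mem_affineWeylGroup_iff_apply_zero_mem_rootSpan P (affineWeylGroup_le_extendedAffineWeylGroup P hw)).mp hw

end Cell

/-! ## §3 «`σ𝔇∘` and `τ𝔇∘` have the same lattice point iff `σW = τW`» -/

section Coset

omit [LinearOrder K] [IsStrictOrderedRing K] [Fintype ι] [DecidableEq ι] [CharZero K] [P.IsCrystallographic] [P.IsReduced] [Nonempty ι] in
/-- ★★ **«`σ(0) = τ(0) ⟺ σW = τW`»**: two elements of `W_a` give their cells the same lattice point iff they differ by an element of `W` on the right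
(«`σ(0) = τ(0) ⟺ σ⁻¹τ(0) = 0 ⟺ σ⁻¹τ ∈ W`», the stabiliser of `0` in `W_a` being `W`, row g44-#13). [cite: IwahoriMatsumoto1965, §1.7 Remark after Corollary 1.20 ("σ𝔇∘ and τ𝔇∘ have the same associated lattice point if and only if σW = τW")] -/
theorem apply_zero_eq_apply_zero_iff_exists_weylGroup {σ τ : M ≃ᵃ[K] M} (hσ : σ ∈ affineWeylGroup P) (hτ : τ ∈ affineWeylGroup P) :
    σ 0 = τ 0 ↔ ∃ g ∈ P.weylGroup, τ = σ * affineHom P g := by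
  constructor
  · intro h
    have h1 : (σ⁻¹ * τ) 0 = 0 := by
      rw [AffineEquiv.coe_mul, comp_apply, ← h, AffineEquiv.inv_def, AffineEquiv.symm_apply_apply]
    obtain ⟨g, hg, hστ⟩ := eq_affineHom_of_apply_zero (mul_mem (inv_mem hσ) hτ) h1
    exact ⟨g, hg, by rw [← hστ, mul_inv_cancel_left]⟩
  · rintro ⟨g, -, rfl⟩
    rw [AffineEquiv.coe_mul, comp_apply, affineHom_apply, smul_zero]

omit [LinearOrder K] [IsStrictOrderedRing K] [Fintype ι] [DecidableEq ι] [CharZero K] [P.IsCrystallographic] [P.IsReduced] [Nonempty ι] in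
/-- ★★ **THE SAME WITH MATHLIB'S LEFT COSETS**: for `σ, τ ∈ W_a`, `σ(0) = τ(0)` iff `σW = τW` in `W_a ⧸ W` (`W` embedded by `affineHom`).
[cite: IwahoriMatsumoto1965, §1.7 Remark after Corollary 1.20 ("σ(0) = τ(0) ⟺ σ⁻¹τ(0) = 0 ⟺ σ⁻¹τ ∈ W")] -/
theorem apply_zero_eq_apply_zero_iff_quotient_eq (σ τ : affineWeylGroup P) :
    (σ : M ≃ᵃ[K] M) 0 = (τ : M ≃ᵃ[K] M) 0 ↔
      (QuotientGroup.mk σ : affineWeylGroup P ⧸ (P.weylGroup.map (affineHom P)).subgroupOf (affineWeylGroup P)) = QuotientGroup.mk τ := by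
  rw [apply_zero_eq_apply_zero_iff_exists_weylGroup σ.2 τ.2, QuotientGroup.eq, Subgroup.mem_subgroupOf, Subgroup.coe_mul, Subgroup.coe_inv,
    Subgroup.mem_map]
  constructor
  · rintro ⟨g, hg, h⟩
    exact ⟨g, hg, by rw [h, inv_mul_cancel_left]⟩
  · rintro ⟨g, hg, h⟩
    exact ⟨g, hg, by rw [h, mul_inv_cancel_left]⟩

end Coset

/-! ## §4 Proposition 1.17: the weights of the closed fundamental cell; Proposition 1.18 on points: `Ā∘ ∩ P(Φ) = Ω·0` -/

section Weights

omit [Nonempty ι] in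
/-- ★★ **PROPOSITION 1.17: `Ā∘ ∩ P(Φ)` CONSISTS OF `0` AND THE MINUSCULE WEIGHTS** — a weight `x` lies in the closed fundamental cell iff it is
dominant with `⟨x, α^∨⟩ ∈ {0, 1, -1}` for every root (the tree's «`0` or minuscule», Bourbaki VIII §7 no. 3: `⟨x, α^∨⟩ ∈ {0, 1}` on `Φ⁺`).
[cite: IwahoriMatsumoto1965, §1.7 Proposition 1.17 ("The intersection of P^⊥ with the closure 𝔇̄∘ of 𝔇∘ consists of 0 and the ε_i with (α₀, ε_i) = 1")] -/
theorem closedFundamentalAlcove_inter_weightLattice :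
    {x : M | ∀ i, b.IsPos i → 0 ≤ P.coroot' i x ∧ P.coroot' i x ≤ 1} ∩ (weightLattice P : Set M) =
      {x : M | (∀ j ∈ b.support, ∃ n : ℕ, P.coroot' j x = n) ∧ ∀ i, P.coroot' i x = 0 ∨ P.coroot' i x = 1 ∨ P.coroot' i x = -1} := by
  letI := P.indexNeg
  ext x
  simp only [mem_inter_iff, mem_setOf_eq, SetLike.mem_coe]
  constructor
  · rintro ⟨hA, hP⟩
    -- on a positive root the level is an integer in `[0, 1]`
    have hpos : ∀ i, b.IsPos i → P.coroot' i x = 0 ∨ P.coroot' i x = 1 := fun i hi ↦ by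
      obtain ⟨m, hm⟩ := hP i
      obtain ⟨h0, h1⟩ := hA i hi
      rw [hm] at h0 h1 ⊢
      have h0' : (0 : ℤ) ≤ m := by exact_mod_cast h0
      have h1' : m ≤ 1 := by exact_mod_cast h1
      rcases (show m = 0 ∨ m = 1 by omega) with rfl | rfl
      · exact Or.inl (by simp)
      · exact Or.inr (by simp)
    refine ⟨fun j hj ↦ ?_, fun i ↦ ?_⟩
    · rcases hpos j (b.isPos_of_mem_support hj) with h | h
      · exact ⟨0, by rw [h, Nat.cast_zero]⟩
      · exact ⟨1, by rw [h, Nat.cast_one]⟩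
    · rcases RootPairing.Base.IsPos.or_neg b i with hi | hi
      · rcases hpos i hi with h | h
        · exact Or.inl h
        · exact Or.inr (Or.inl h)
      · have hneg : P.coroot' (-i) x = -P.coroot' i x := coroot'_indexNeg i x
        rcases hpos (-i) hi with h | h
        · exact Or.inl (by rw [hneg] at h; exact neg_eq_zero.mp h)
        · exact Or.inr (Or.inr (by rw [hneg] at h; linear_combination -h))
  · rintro ⟨hdom, hall⟩
    have hdom' : ∀ j ∈ b.support, 0 ≤ P.coroot' j x := fun j hj ↦ by
      obtain ⟨n, hn⟩ := hdom j hj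
      rw [hn]; exact Nat.cast_nonneg n
    refine ⟨fun i hi ↦ ?_, fun i ↦ ?_⟩
    · have h0 := coroot'_nonneg_of_isPos_of_forall_mem_support b hdom' hi
      rcases hall i with h | h | h
      · rw [h]; exact ⟨le_rfl, zero_le_one⟩
      · rw [h]; exact ⟨zero_le_one, le_rfl⟩
      · rw [h] at h0; norm_num at h0
    · rcases hall i with h | h | h
      · exact ⟨0, by rw [h, Int.cast_zero]⟩
      · exact ⟨1, by rw [h, Int.cast_one]⟩
      · exact ⟨-1, by rw [h, Int.cast_neg, Int.cast_one]⟩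

include hη

/-- ★★★ **PROPOSITION 1.18 ON POINTS: `o ↦ o(0)` IS A BIJECTION FROM `Ω` ONTO THE WEIGHTS OF THE CLOSED FUNDAMENTAL CELL `Ā∘ ∩ P(Φ)`** («the
mapping from the set `{0} ∪ {ε_i; (α₀, ε_i) = 1}` onto `Ω` … is bijective», read backwards). Into: `o(0) ∈ P(Φ)` is `0` or minuscule (row g44-#8).
Injective: `Ω`-elements with the same translation part coincide (row g44-#8). Onto: for a weight `d` of `Ā∘`, write `t(d) = w·o` (`w ∈ W_a`, `o ∈ Ω`);
then `w(o(0)) = d` with both `o(0)` and `d` in `Ā∘`, so `o(0) = d` by the fundamental-domain theorem (row g44-#9).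
[cite: IwahoriMatsumoto1965, §1.7 Propositions 1.17–1.18] [cite: Humphreys1990, §4.8 Theorem] -/
theorem bijOn_apply_zero_stabilizer :
    Set.BijOn (fun o : M ≃ᵃ[K] M ↦ o 0)
      {o : M ≃ᵃ[K] M | o ∈ extendedAffineWeylGroup P ∧
        o '' {x : M | ∀ i, b.IsPos i → 0 < P.coroot' i x ∧ P.coroot' i x < 1} = {x : M | ∀ i, b.IsPos i → 0 < P.coroot' i x ∧ P.coroot' i x < 1}}
      ({x : M | ∀ i, b.IsPos i → 0 ≤ P.coroot' i x ∧ P.coroot' i x ≤ 1} ∩ (weightLattice P : Set M)) := by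
  -- the translation part of an element of `Ω` is a weight of `Ā∘`
  have hinto : ∀ o : M ≃ᵃ[K] M, o ∈ extendedAffineWeylGroup P →
      o '' {x : M | ∀ i, b.IsPos i → 0 < P.coroot' i x ∧ P.coroot' i x < 1} = {x : M | ∀ i, b.IsPos i → 0 < P.coroot' i x ∧ P.coroot' i x < 1} →
      o 0 ∈ {x : M | ∀ i, b.IsPos i → 0 ≤ P.coroot' i x ∧ P.coroot' i x ≤ 1} ∩ (weightLattice P : Set M) := by
    intro o ho hoA
    rw [closedFundamentalAlcove_inter_weightLattice b]
    obtain ⟨h1, h2⟩ := forall_coroot'_apply_zero_mem_of_image_eq b hη ho hoA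
    refine ⟨fun j hj ↦ ?_, h2⟩
    rcases h1 j hj with h | h
    · exact ⟨0, by rw [h, Nat.cast_zero]⟩
    · exact ⟨1, by rw [h, Nat.cast_one]⟩
  refine ⟨fun o ho ↦ hinto o ho.1 ho.2, fun o ho o' ho' h ↦ ?_, fun d hd ↦ ?_⟩
  · exact eq_of_apply_zero_sub_apply_zero_mem_rootSpan b hη ho.1 ho'.1 ho.2 ho'.2 (by
      have h' : o 0 = o' 0 := h
      rw [h', sub_self]; exact Submodule.zero_mem _)
  · obtain ⟨hdA, hdP⟩ := hd
    have htd : AffineEquiv.constVAdd K M d ∈ extendedAffineWeylGroup P := constVAdd_mem_extendedAffineWeylGroup P hdP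
    obtain ⟨w, hw, o, ho, hoA, hwo⟩ := exists_mem_affineWeylGroup_mul_of_mem_extendedAffineWeylGroup b hη htd
    refine ⟨o, ⟨ho, hoA⟩, ?_⟩
    -- `w (o 0) = t(d) 0 = d`, both in `Ā∘`
    have h1 : w (o 0) = d := by
      have := congrArg (fun e : M ≃ᵃ[K] M ↦ e 0) hwo
      simp only [AffineEquiv.constVAdd_apply, vadd_eq_add, add_zero, AffineEquiv.coe_mul, comp_apply] at this
      exact this.symm
    exact eq_of_apply_eq_of_mem_closedFundamentalAlcove b hη hw (hinto o ho hoA).1 hdA h1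

/-- ★ **`Ā∘ ∩ P(Φ) = Ω·0`**: the weights of the closed fundamental cell are exactly the translation parts of the elements of `Ω` (so there are `|Ω| =
[P(Φ) : Q]` of them, rows g45-#10 ∕ g39-#3). [cite: IwahoriMatsumoto1965, §1.7 Propositions 1.17–1.18 and Corollary 1.19] -/
theorem closedFundamentalAlcove_inter_weightLattice_eq_image :
    {x : M | ∀ i, b.IsPos i → 0 ≤ P.coroot' i x ∧ P.coroot' i x ≤ 1} ∩ (weightLattice P : Set M) =
      (fun o : M ≃ᵃ[K] M ↦ o 0) '' {o : M ≃ᵃ[K] M | o ∈ extendedAffineWeylGroup P ∧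
        o '' {x : M | ∀ i, b.IsPos i → 0 < P.coroot' i x ∧ P.coroot' i x < 1} = {x : M | ∀ i, b.IsPos i → 0 < P.coroot' i x ∧ P.coroot' i x < 1}} :=
  (bijOn_apply_zero_stabilizer b hη).image_eq.symm

end Weights

end Base

end Literature.LinearAlgebra.RootSystem
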